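import Summits.NavierStokesRegularity.NavierStokesRegularity.Theorems.LerayQuarterDissipationFiniteDissipationLiouvilleCriticalElement
import Summits.NavierStokesRegularity.NavierStokesRegularity.Theorems.LerayQuarterDissipationFiniteDissipationLiouvilleFinalDatumProfile
import Summits.NavierStokesRegularity.NavierStokesRegularity.Theorems.LerayQuarterDissipationFiniteDissipationLiouvilleTraceMorrey
import Summits.NavierStokesRegularity.NavierStokesRegularity.Theorems.CalmSliceGatePerpetualFlickerLiouvilleLinks
import Summits.NavierStokesRegularity.NavierStokesRegularity.Theorems.QuarterLogPincerTypeIQuantSubcubicExpLiouvilleEdges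
import Literature.Analysis.FluidPDE.NewtonKernelLogPotential
import Literature.Analysis.PDE.NewtonianKernel
import HarnessLib

/-!
# Stub S3 `stub_thinCascadeLiouville` of crux `TypeIQuantSubcubicExp` (stmt-NavierStokesRegularity-24077,
# line `thin_cascade`): the thin-cascade Liouville statement IMPLIES `FiniteDissipationLiouville`
# (stmt-22144) — every counterexample to LQD's crux is a thin singular Type-I object

Refuter-side negative-lane file (seat ns-afl-r1 g6, `--supports stmt-NavierStokesRegularity-24077`).
Navier–Stokes regularity is NOT proved by anything here; no summit statement is; S3, 24077, 22144,
24374, 24453 all stay OPEN.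

The only open stub of the registered line `Cruxes/TypeIQuantSubcubicExp/Lines/thin_cascade.lean` is
S3: `∀ M q v g, ¬ ThinObject M q v g` — no Type-I ancient mild field (KNSS gauge, constant `M`) that is
uniformly locally square-integrable up to the apex, singular at the space–time origin, and has a
locally integrable distributional trace `g` at `t = 0` with the thin annulus budget
`∫_{1<|x|<R} |g|³ ≤ q(1 + log R)`.  LQD's crux `FiniteDissipationLiouville` (22144) says that no
member of a finite-dissipation stratum `𝒟_{C,K}` (`IsTypeIAncientMild C u` + Leray's slice law
`∫|∇u(s)|² ≤ K/√(−s)`) is singular at the apex.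

* `exists_thinObject_of_singular_member` — **a singular member of `𝒟_{C,K}` yields a thin object**,
  with explicit constants: the route's CRITICAL ELEMENT `w ∈ 𝒟_{C,K_c}`, `K_c ≤ K`
  (`CriticalElement.exists_minimal_singular`, lead g6) carries the envelope `|w| ≤ A/(|x|+√(−t))`
  and a final datum `g = u₀` with `|u₀(x)| ≤ A/|x|`, attained at the rate `(−t)|x|⁻³` off the apex
  (`FinalDatum.finalDatum_profile_of_minimal`, lead g7); then (2) uniform local energy is the
  no-energy-atom bound `∫_{B(x₀,1)}|w(t)|² ≤ Λ(K_c)` (`Birth.Apex.lintegral_ball_sq_le_unif`, lead g5),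
  (4) `u₀ ∈ L¹_loc` from `|x|⁻¹ ∈ L¹_loc(ℝ³)`, (5) the trace for EVERY smooth compactly supported test
  (support through the apex included) by dominated convergence with the integrable majorant
  `A|φ|/|x|`, and (6) the annulus budget with `q = 3|B₁|A³` from `∫_{1<|x|<R}|x|⁻³ = 3|B₁| log R`.
* `exists_thinObject_of_not_finiteDissipationLiouville`, `finiteDissipationLiouville_of_thinCascadeLiouville`
  — hence **S3 ⇒ 22144**, and with the landed links **S3 ⇒ PerpetualFlickerLiouville (24374)** and
  **S3 ⇒ AsymmetricFlickerLiouville (24453)**; `thinCascadeLiouville_closes_four` records S3 ⇒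
  24077 ∧ 22144 ∧ 24374 ∧ 24453 in one line (the first conjunct is the lead's
  `ThinCascade.typeIQuantSubcubicExp_of_thinCascadeLiouville`).

READING (refuter / instrument, numbers not adjectives): the refutation-candidate class of S3 is not
"backward-DSS profiles with a trace" but contains EVERY singular member of EVERY stratum `𝒟_{C,K}`
— the trace and the log-thin budget are THEOREMS for the critical element, not hypotheses — so a
resident candidate of the 24453/22144 stratum table is automatically an S3 refutation candidate with
`(M, q) = (C, 3|B₁|A(C,K_c)³)`; conversely a proof of S3 closes four crux items.  S3 is therefore at
least as hard as Bradshaw–Tsai OP 5.1 ∩ finite dissipation.  Nothing here bears on the truth of S3.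
No definitions; standard axioms.
-/

noncomputable section

-- the summit and its single sub-problem share the name (CONVENTIONS §1), as in every Theorems file
set_option linter.dupNamespace false

namespace Summit.NavierStokesRegularity.NavierStokesRegularity.Theorems.TypeIQuantSubcubicExp.Negative

open MeasureTheory Set Filter Topology Metric Function
open Literature.Analysis Literature.Analysis.FluidPDE
open Summit.NavierStokesRegularity.NavierStokesRegularity.Theorems
open Summit.NavierStokesRegularity.NavierStokesRegularity.Theorems.FiniteDissipationLiouville
open Summit.NavierStokesRegularity.NavierStokesRegularity.Cruxes.TypeIQuantSubcubicExp.ThinCascade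
  (ThinObject SingularAt)
open scoped ENNReal NNReal RealInnerProductSpace

/-! ### Two measure-theoretic helpers on `ℝ³` -/

/-- Almost every point of `ℝ³` is not the origin. [folklore] -/
theorem ae_ne_zero : ∀ᵐ x : EuclideanSpace ℝ (Fin 3) ∂volume, x ≠ 0 := by
  rw [ae_iff]
  have h : {a : EuclideanSpace ℝ (Fin 3) | ¬ a ≠ 0} = {0} := by ext; simp
  rw [h]
  exact measure_singleton 0

/-- `ψ(x)|x|⁻¹` is integrable on `ℝ³` for a bounded, a.e. strongly measurable `ψ` vanishing off a
ball (`|x|⁻¹ ∈ L¹_loc(ℝ³)`). [folklore] -/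
theorem integrable_mul_norm_rpow_neg_one {ψ : EuclideanSpace ℝ (Fin 3) → ℝ}
    (hψm : AEStronglyMeasurable ψ volume) {B : ℝ} (hB : ∀ x, ‖ψ x‖ ≤ B) {R : ℝ}
    (hR : ∀ x, ψ x ≠ 0 → ‖x‖ < R) :
    Integrable (fun x : EuclideanSpace ℝ (Fin 3) => ψ x * ‖x‖ ^ (-1 : ℝ)) volume := by
  have hsupp : support (fun x : EuclideanSpace ℝ (Fin 3) => ψ x * ‖x‖ ^ (-1 : ℝ)) ⊆
      ball (0 : EuclideanSpace ℝ (Fin 3)) R := by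
    intro x hx
    rw [mem_ball_zero_iff]
    refine hR x fun h0 => hx ?_
    simp [h0]
  rw [← integrableOn_iff_integrable_of_support_subset hsupp]
  have hint : IntegrableOn (fun x : EuclideanSpace ℝ (Fin 3) => ‖x‖ ^ (-1 : ℝ))
      (ball (0 : EuclideanSpace ℝ (Fin 3)) R) :=
    PDE.Newtonian.integrableOn_ball_norm_rpow_neg (E := EuclideanSpace ℝ (Fin 3))
      (by rw [finrank_euclideanSpace_fin]) (by rw [finrank_euclideanSpace_fin]; norm_num) R
  exact Integrable.bdd_mul (c := B) hint hψm.restrict (Eventually.of_forall hB)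

/-! ### A singular member of a finite-dissipation stratum is a thin object -/

/-- **Every singular member of `𝒟_{C,K}` yields a thin singular Type-I object** (the negation of S3
`stub_thinCascadeLiouville`), with explicit constants: the critical element `w ∈ 𝒟_{C,K_c}`,
`K_c ≤ K`, of the stratum, its envelope constant `A ≥ 0` (`|w(t,x)| ≤ A/(|x|+√(−t))`), and its final
datum `g` (`|g(x)| ≤ A/|x|` off the apex) form `ThinObject C (3|B₁|A³) w g`. [folklore] -/
theorem exists_thinObject_of_singular_member {C K : ℝ}
    {u : ℝ → EuclideanSpace ℝ (Fin 3) → EuclideanSpace ℝ (Fin 3)} (hu : IsTypeIAncientMild C u)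
    (hlaw : ∀ s : ℝ, s < 0 → ∫⁻ x, ‖fderiv ℝ (u s) x‖ₑ ^ 2 ≤ ENNReal.ofReal (K / Real.sqrt (-s)))
    (hsing : ∀ r > 0, ∀ M : ℝ, ∃ t ∈ Set.Ioo (-(r ^ 2)) (0 : ℝ),
      ∃ x ∈ Metric.ball (0 : EuclideanSpace ℝ (Fin 3)) r, M < ‖u t x‖) :
    ∃ (Kc A : ℝ) (w : ℝ → EuclideanSpace ℝ (Fin 3) → EuclideanSpace ℝ (Fin 3))
      (g : EuclideanSpace ℝ (Fin 3) → EuclideanSpace ℝ (Fin 3)),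
      Kc ≤ K ∧ 0 ≤ A ∧ IsTypeIAncientMild C w ∧
      (∀ s : ℝ, s < 0 → ∫⁻ x, ‖fderiv ℝ (w s) x‖ₑ ^ 2 ≤ ENNReal.ofReal (Kc / Real.sqrt (-s))) ∧
      HasTypeIDecay A w ∧
      (∀ x : EuclideanSpace ℝ (Fin 3), x ≠ 0 → ‖g x‖ ≤ A / ‖x‖) ∧
      ThinObject C (3 * (volume : Measure (EuclideanSpace ℝ (Fin 3))).real (ball 0 1) * A ^ 3)
        w g := by
  obtain ⟨Kc, hKcK, ⟨w, hw, hlaww, hsingw⟩, hmin⟩ :=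
    CriticalElement.exists_minimal_singular hu hlaw hsing
  obtain ⟨A, L₀, L₁, u₀, Du₀, hA0, -, -, hdec, hrate, henv, -, -, hderiv, -, -⟩ :=
    FinalDatum.finalDatum_profile_of_minimal hmin hw hlaww hsingw
  have hcB0 : 0 ≤ 3 * (volume : Measure (EuclideanSpace ℝ (Fin 3))).real (ball 0 1) :=
    NewtonPotentialHolder.three_mul_volume_real_ball_nonneg
  -- a.e. strong measurability of the final datum (continuous off the apex)
  have hcont : ContinuousOn u₀ ({0}ᶜ : Set (EuclideanSpace ℝ (Fin 3))) := fun x hx =>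
    (hderiv x hx).continuousAt.continuousWithinAt
  have hmeas : AEStronglyMeasurable u₀ (volume : Measure (EuclideanSpace ℝ (Fin 3))) := by
    have h1 : AEStronglyMeasurable u₀
        ((volume : Measure (EuclideanSpace ℝ (Fin 3))).restrict ({0}ᶜ)) :=
      hcont.aestronglyMeasurable (measurableSet_singleton 0).compl
    rwa [Measure.restrict_eq_self_of_ae_mem] at h1
    exact ae_ne_zero.mono fun x hx => mem_compl_singleton_iff.2 hx
  -- the pointwise envelope of the final datum in `rpow` form
  have henv' : ∀ x : EuclideanSpace ℝ (Fin 3), x ≠ 0 → ‖u₀ x‖ ≤ A * ‖x‖ ^ (-1 : ℝ) := fun x hx => by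
    rw [Real.rpow_neg_one, ← div_eq_mul_inv]; exact henv x hx
  refine ⟨Kc, A, w, u₀, hKcK, hA0, hw, hlaww, hdec, henv, hw, ?_, fun r hr M => hsingw r hr M, ?_,
    ?_, ?_⟩
  · -- (2) uniform local energy up to the apex: no energy atom (lead g5)
    obtain ⟨Λ, hΛ⟩ := Birth.Apex.lintegral_ball_sq_le_unif Kc
    refine ⟨(Λ : ℝ), fun x₀ t ht => ?_⟩
    have h := hΛ C w hw hlaww x₀ 1 one_pos t (by simpa using ht)
    calc ∫⁻ y in ball x₀ 1, ENNReal.ofReal (‖w t y‖ ^ 2)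
        = ∫⁻ y in ball x₀ 1, ‖w t y‖ₑ ^ 2 := by
          refine lintegral_congr fun y => ?_
          rw [← ofReal_norm, ENNReal.ofReal_pow (norm_nonneg _)]
      _ ≤ ENNReal.ofReal 1 * Λ := h
      _ = ENNReal.ofReal (Λ : ℝ) := by
          rw [ENNReal.ofReal_one, one_mul, ENNReal.ofReal_coe_nnreal]
  · -- (4) the final datum is locally integrable: `|u₀| ≤ A/|x|`
    rw [locallyIntegrable_iff]
    intro S hS
    obtain ⟨R, hR⟩ := hS.isBounded.subset_ball 0
    refine IntegrableOn.mono_set ?_ hR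
    have hint : IntegrableOn (fun x : EuclideanSpace ℝ (Fin 3) => ‖x‖ ^ (-1 : ℝ))
        (ball (0 : EuclideanSpace ℝ (Fin 3)) R) :=
      PDE.Newtonian.integrableOn_ball_norm_rpow_neg (E := EuclideanSpace ℝ (Fin 3))
        (by rw [finrank_euclideanSpace_fin]) (by rw [finrank_euclideanSpace_fin]; norm_num) R
    refine Integrable.mono' (hint.const_mul A) hmeas.restrict ?_
    filter_upwards [ae_restrict_of_ae (s := ball (0 : EuclideanSpace ℝ (Fin 3)) R) ae_ne_zero]
      with x hx
    exact henv' x hx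
  · -- (5) the distributional trace at the apex IS `u₀`, for every test field (dominated convergence)
    intro φ hφ hφc
    have hφcont : Continuous φ := hφ.continuous
    obtain ⟨B, hB⟩ := hφcont.bounded_above_of_compact_support hφc
    obtain ⟨R, hR⟩ := hφc.isCompact.isBounded.subset_ball (0 : EuclideanSpace ℝ (Fin 3))
    have hev : ∀ᶠ t in 𝓝[<] (0 : ℝ), t < 0 := eventually_mem_nhdsWithin
    refine tendsto_integral_filter_of_dominated_convergence
      (fun x => A * ‖φ x‖ * ‖x‖ ^ (-1 : ℝ)) ?_ ?_ ?_ ?_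
    · filter_upwards [hev] with t ht
      exact ((hw.continuous_slice ht).inner hφcont).aestronglyMeasurable
    · filter_upwards [hev] with t ht
      filter_upwards [ae_ne_zero] with x hx
      have hxpos : 0 < ‖x‖ := norm_pos_iff.2 hx
      have h1 : ‖w t x‖ ≤ A / ‖x‖ :=
        (hdec t ht x).trans
          (div_le_div_of_nonneg_left hA0 hxpos (le_add_of_nonneg_right (Real.sqrt_nonneg _)))
      calc ‖⟪w t x, φ x⟫‖ ≤ ‖w t x‖ * ‖φ x‖ := norm_inner_le_norm _ _
        _ ≤ A / ‖x‖ * ‖φ x‖ := mul_le_mul_of_nonneg_right h1 (norm_nonneg _)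
        _ = A * ‖φ x‖ * ‖x‖ ^ (-1 : ℝ) := by rw [Real.rpow_neg_one, div_eq_mul_inv]; ring
    · refine integrable_mul_norm_rpow_neg_one (ψ := fun x => A * ‖φ x‖)
        (continuous_const.mul hφcont.norm).aestronglyMeasurable (B := |A| * B) (fun x => ?_)
        (R := R) (fun x hx => ?_)
      · rw [norm_mul, Real.norm_eq_abs, norm_norm]
        exact mul_le_mul_of_nonneg_left (hB x) (abs_nonneg A)
      · have hφx : φ x ≠ 0 := fun h => hx (by simp [h])
        exact mem_ball_zero_iff.1 (hR (subset_tsupport φ (mem_support.2 hφx)))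
    · filter_upwards [ae_ne_zero] with x hx
      have hlim : Tendsto (fun t => w t x) (𝓝[<] 0) (𝓝 (u₀ x)) := by
        rw [tendsto_iff_norm_sub_tendsto_zero]
        have h0 : Tendsto (fun t : ℝ => L₀ * (-t) / ‖x‖ ^ 3) (𝓝[<] 0) (𝓝 0) := by
          have hc : Continuous (fun t : ℝ => L₀ * (-t) / ‖x‖ ^ 3) :=
            (continuous_const.mul continuous_neg).div_const _
          have h := hc.tendsto 0
          simp only [neg_zero, mul_zero, zero_div] at h
          exact h.mono_left nhdsWithin_le_nhds
        refine squeeze_zero' (Eventually.of_forall fun t => norm_nonneg _) ?_ h0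
        filter_upwards [hev] with t ht
        exact hrate x hx t ht
      exact hlim.inner tendsto_const_nhds
  · -- (6) the thin annulus budget: `|u₀|³ ≤ A³|x|⁻³` and `∫_{1<|x|<R} |x|⁻³ = 3|B₁| log R`
    intro R hR1
    have hA3 : 0 ≤ A ^ 3 := pow_nonneg hA0 3
    have hsub : {x : EuclideanSpace ℝ (Fin 3) | 1 < ‖x‖ ∧ ‖x‖ < R} ⊆
        ball (0 : EuclideanSpace ℝ (Fin 3)) R \ ball 0 1 := by
      intro x hx
      refine ⟨mem_ball_zero_iff.2 hx.2, fun h => ?_⟩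
      rw [mem_ball_zero_iff] at h
      linarith [hx.1]
    have hmeasS : MeasurableSet {x : EuclideanSpace ℝ (Fin 3) | 1 < ‖x‖ ∧ ‖x‖ < R} :=
      (measurableSet_lt measurable_const measurable_norm).inter
        (measurableSet_lt measurable_norm measurable_const)
    calc ∫⁻ x in {x : EuclideanSpace ℝ (Fin 3) | 1 < ‖x‖ ∧ ‖x‖ < R}, ENNReal.ofReal (‖u₀ x‖ ^ 3)
        ≤ ∫⁻ x in {x : EuclideanSpace ℝ (Fin 3) | 1 < ‖x‖ ∧ ‖x‖ < R},
            ENNReal.ofReal (A ^ 3 * ‖x‖ ^ (-3 : ℝ)) := by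
          refine setLIntegral_mono' hmeasS fun x hx => ENNReal.ofReal_le_ofReal ?_
          have hxpos : 0 < ‖x‖ := by linarith [hx.1]
          have hx0 : x ≠ 0 := norm_pos_iff.1 hxpos
          have e3 : ‖x‖ ^ (-3 : ℝ) = (‖x‖ ^ 3)⁻¹ := by
            rw [Real.rpow_neg (norm_nonneg _)]
            norm_num
          calc ‖u₀ x‖ ^ 3 ≤ (A / ‖x‖) ^ 3 := pow_le_pow_left₀ (norm_nonneg _) (henv x hx0) 3
            _ = A ^ 3 * ‖x‖ ^ (-3 : ℝ) := by rw [e3, div_pow, div_eq_mul_inv]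
      _ ≤ ∫⁻ x in ball (0 : EuclideanSpace ℝ (Fin 3)) R \ ball 0 1,
            ENNReal.ofReal (A ^ 3 * ‖x‖ ^ (-3 : ℝ)) := lintegral_mono_set hsub
      _ = ENNReal.ofReal (A ^ 3) *
            ∫⁻ x in ball (0 : EuclideanSpace ℝ (Fin 3)) R \ ball 0 1,
              ENNReal.ofReal (‖x‖ ^ (-3 : ℝ)) := by
          rw [← lintegral_const_mul' _ _ ENNReal.ofReal_ne_top]
          exact lintegral_congr fun x => ENNReal.ofReal_mul hA3
      _ = ENNReal.ofReal (A ^ 3) * ENNReal.ofReal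
            (3 * (volume : Measure (EuclideanSpace ℝ (Fin 3))).real (ball 0 1) *
              Real.log (R / 1)) := by
          rw [NewtonPotentialHolder.lintegral_annulus_norm_rpow_neg_three one_pos hR1]
      _ = ENNReal.ofReal (A ^ 3 *
            (3 * (volume : Measure (EuclideanSpace ℝ (Fin 3))).real (ball 0 1) * Real.log R)) := by
          rw [div_one, ← ENNReal.ofReal_mul hA3]
      _ ≤ ENNReal.ofReal (3 * (volume : Measure (EuclideanSpace ℝ (Fin 3))).real (ball 0 1) *
            A ^ 3 * (1 + Real.log R)) := by
          refine ENNReal.ofReal_le_ofReal ?_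
          have hlog : 0 ≤ Real.log R := Real.log_nonneg hR1
          nlinarith [mul_nonneg hcB0 hA3]

/-! ### S3 ⇒ 22144 ⇒ 24374, 24453 (and 24077) -/

/-- **A counterexample to `FiniteDissipationLiouville` is a thin object**: if 22144 fails, some
`ThinObject M q v g` exists (so S3 fails). [folklore] -/
theorem exists_thinObject_of_not_finiteDissipationLiouville
    (h : ¬ Summit.NavierStokesRegularity.NavierStokesRegularity.Theses.LerayQuarterDissipation.FiniteDissipationLiouville) :
    ∃ (M q : ℝ) (v : ℝ → EuclideanSpace ℝ (Fin 3) → EuclideanSpace ℝ (Fin 3))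
      (g : EuclideanSpace ℝ (Fin 3) → EuclideanSpace ℝ (Fin 3)), ThinObject M q v g := by
  unfold Summit.NavierStokesRegularity.NavierStokesRegularity.Theses.LerayQuarterDissipation.FiniteDissipationLiouville at h
  push Not at h
  obtain ⟨C, K, u, hu, hlaw, hsing⟩ := h
  obtain ⟨-, A, w, g, -, -, -, -, -, -, hthin⟩ := exists_thinObject_of_singular_member hu hlaw hsing
  exact ⟨C, _, w, g, hthin⟩

/-- **S3 ⇒ 22144**: the thin-cascade Liouville statement (the registered signature of
`stub_thinCascadeLiouville`, hypothesis only — nothing about it is asserted) implies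
`FiniteDissipationLiouville`. [folklore] -/
theorem finiteDissipationLiouville_of_thinCascadeLiouville
    (hS3 : ∀ (M q : ℝ) (v : ℝ → EuclideanSpace ℝ (Fin 3) → EuclideanSpace ℝ (Fin 3))
      (g : EuclideanSpace ℝ (Fin 3) → EuclideanSpace ℝ (Fin 3)), ¬ ThinObject M q v g) :
    Summit.NavierStokesRegularity.NavierStokesRegularity.Theses.LerayQuarterDissipation.FiniteDissipationLiouville := by
  by_contra h
  obtain ⟨M, q, v, g, hthin⟩ := exists_thinObject_of_not_finiteDissipationLiouville h
  exact hS3 M q v g hthin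

/-- **S3 ⇒ 24374** (`PerpetualFlickerLiouville`, through the landed
`finiteDissipationLiouville_iff_perpetualFlickerLiouville`). [folklore] -/
theorem perpetualFlickerLiouville_of_thinCascadeLiouville
    (hS3 : ∀ (M q : ℝ) (v : ℝ → EuclideanSpace ℝ (Fin 3) → EuclideanSpace ℝ (Fin 3))
      (g : EuclideanSpace ℝ (Fin 3) → EuclideanSpace ℝ (Fin 3)), ¬ ThinObject M q v g) :
    Summit.NavierStokesRegularity.NavierStokesRegularity.Theses.CalmSliceGate.PerpetualFlickerLiouville :=
  PerpetualFlickerLiouville.Links.finiteDissipationLiouville_iff_perpetualFlickerLiouville.1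
    (finiteDissipationLiouville_of_thinCascadeLiouville hS3)

/-- **S3 ⇒ 24453** (`AsymmetricFlickerLiouville`: restrict 22144 to the flickering, asymmetric
members). [folklore] -/
theorem asymmetricFlickerLiouville_of_thinCascadeLiouville
    (hS3 : ∀ (M q : ℝ) (v : ℝ → EuclideanSpace ℝ (Fin 3) → EuclideanSpace ℝ (Fin 3))
      (g : EuclideanSpace ℝ (Fin 3) → EuclideanSpace ℝ (Fin 3)), ¬ ThinObject M q v g) :
    Summit.NavierStokesRegularity.NavierStokesRegularity.Theses.CalmSliceGate.AsymmetricFlickerLiouville := by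
  intro C K _ _ _ _ _ _ _ _ w hw hlaw _ _
  exact finiteDissipationLiouville_of_thinCascadeLiouville hS3 C K w hw hlaw

/-- **One stub behind four cruxes**: S3 implies `TypeIQuantSubcubicExp` (24077, the lead's edge),
`FiniteDissipationLiouville` (22144), `PerpetualFlickerLiouville` (24374) and
`AsymmetricFlickerLiouville` (24453). CONDITIONAL on S3 (open); nothing is closed. [folklore] -/
theorem thinCascadeLiouville_closes_four
    (hS3 : ∀ (M q : ℝ) (v : ℝ → EuclideanSpace ℝ (Fin 3) → EuclideanSpace ℝ (Fin 3))
      (g : EuclideanSpace ℝ (Fin 3) → EuclideanSpace ℝ (Fin 3)), ¬ ThinObject M q v g) :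
    Summit.NavierStokesRegularity.NavierStokesRegularity.Theses.QuarterLogPincer.TypeIQuantSubcubicExp ∧
    Summit.NavierStokesRegularity.NavierStokesRegularity.Theses.LerayQuarterDissipation.FiniteDissipationLiouville ∧
    Summit.NavierStokesRegularity.NavierStokesRegularity.Theses.CalmSliceGate.PerpetualFlickerLiouville ∧
    Summit.NavierStokesRegularity.NavierStokesRegularity.Theses.CalmSliceGate.AsymmetricFlickerLiouville :=
  ⟨ThinCascade.typeIQuantSubcubicExp_of_thinCascadeLiouville hS3,
    finiteDissipationLiouville_of_thinCascadeLiouville hS3,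
    perpetualFlickerLiouville_of_thinCascadeLiouville hS3,
    asymmetricFlickerLiouville_of_thinCascadeLiouville hS3⟩

end Summit.NavierStokesRegularity.NavierStokesRegularity.Theorems.TypeIQuantSubcubicExp.Negative

end
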